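import Summits.BirchSwinnertonDyer.Rank1Residual.WAll.AltClosersGlueFinest
import Summits.BirchSwinnertonDyer.Rank1Residual.WAll.AltClosersResidualCellsAtTwoR0Partner
import Summits.BirchSwinnertonDyer.Rank1Residual.WAll.TargetAtTwoThetaSlices
import HarnessLib

/-!
# Rung W-ALL (D-0120): the finest registry WITH ROW 1 CUT ALONG THE THETA HABITAT — route
# `ThetaPartnerAtTwo`'s attacked cell `WAllNonCMAtTwoThetaHabitat` and its residual
# `WAllNonCMAtTwoOffThetaHabitat` (= item 20334) as named leaves (cell `bsd-wall`, lane 2, seat ty-2 g5)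

HONEST FRAMING (cell `bsd-wall`, run/shared/lean/pub/bsd-wall/; WALL-BRIEF-v1 §2; companion of
`WAll/AltClosersGlueFinest.lean` (p516556) and of ty-1 g6's `WAll/TargetAtTwoThetaSlices.lean`
(p516700; bsd-wall-p2 g4 «TYPE IT» 2026-08-27T09:00Z), same rules: NOTHING ASSERTED, no `def`, no
`@[conjecture]`, no named fact, no route file imported).

Row 1 of the closed list (`NonCMAtTwo`, rung K4) ⟺ `WAllNonCMAtTwoThetaHabitat` (non-CM, `r_an = 0`,
good supersingular at `2`, `a₂ = 0`, `E[2] ≃_{Γ_ℚ} A[2]` for a rank-`0` CM good-supersingular partner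
`A` with `a₂(A) = 0` ⇒ `BSD(E,2)`; 19 classes of record — the attacked cell of `ThetaPartnerAtTwo`)
∧ `WAllNonCMAtTwoOffThetaHabitat` (= item 20334 verbatim; rung-K4 territory) —
`nonCMAtTwo_iff_thetaHabitat_offThetaHabitat` (ty-1 g6, exact). The leaf shapes ARE the hypothesis
shapes `hHab` / `hOff` of `AltClosersResidualCellsAtTwoR0Partner.lean` (p514468), so its closers
apply to the named leaves by `rfl`:

* §1 `wAllNonCMAtTwoOffThetaHabitat_of_nonCMAtTwo` (⇐ LEAF K4),
  `wAllNonCMAtTwoOffThetaHabitat_of_reductionTypesAtTwo_of_ssOffHabitat` (⇐ K4 route items 19095 /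
  19096 / 19098 / 19099 verbatim + 19097 off the habitat), `supersingularRankZeroAtTwo_of_thetaLeaves_of_ssOffHabitat`
  (item 19097 ⇐ the habitat leaf + the off-habitat supersingular remainder);
* §2 THE FINEST REGISTRY with row 1 = habitat leaf + off-habitat leaf (27 leaf/target hypotheses):
  `wAllExclusions_of_finestLeaves_theta`, `wAll_of_finestLeaves_theta_primaryGZ` (+ FIFTEEN named
  facts), `wAllFormula_of_finestLeaves_theta_primaryGZ` (+ `hL0`).

With this file every live lane-3 route's ATTACKED CELL is one named hypothesis of one registry theorem:
`WAllNonCMAtTwoThetaHabitat` (TPT) · `WAllExclAddWildRankOneSurjTwin` (UTD) ·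
`WAllExclAdditiveFiveLeRankOneSharp` (AKR) · `WAllCornerX7FiveLe` (SBC) · `WAllCornerFInertBadFiveLe`
(BED), next to the registered rung leaves and the typed residuals. No census number moves; typed ≠
proved ≠ endorsed; BSD is not proved by any of this.

References: `WAll/AltClosersGlueFinest.lean` (p516556), `WAll/AltClosersResidualCellsAtTwoR0Partner.lean`
(p514468), `WAll/TargetAtTwoThetaSlices.lean` (p516700); [cite: Miller2011LMS, §1 and Def. 1.1];
[cite: Darmon2004, Thm. 3.22 and §3.9]; [cite: Kobayashi2003, Thm. 1.2 and Thm. 4.1 (shape only)].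
-/

noncomputable section

open scoped Classical

open WeierstrassCurve Literature.NumberTheory.EllipticCurves
  Literature.NumberTheory.EllipticCurves.Rank1Residual
  Literature.NumberTheory.EllipticCurves.Rank1Residual.Typed
  Literature.NumberTheory.EllipticCurves.Wuthrich2014
  Literature.NumberTheory.EllipticCurves.ModularForms

set_option autoImplicit false

namespace Summit.BirchSwinnertonDyer.Rank1Residual.WAll

open Summit.BirchSwinnertonDyer
open Summit.BirchSwinnertonDyer.BirchSwinnertonDyer.Rank1Residual (NonCMAtTwo BSDpOnClassX9)

/-! ## §1 The theta leaves by name from rung K4 -/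

/-- **The off-habitat leaf `WAllNonCMAtTwoOffThetaHabitat` (= item 20334) ⇐ LEAF K4 `NonCMAtTwo`**
(`offThetaHabitatAtTwo_r0Partner_of_nonCMAtTwo`, same shape by `rfl`). [folklore] -/
theorem wAllNonCMAtTwoOffThetaHabitat_of_nonCMAtTwo (h : NonCMAtTwo) : WAllNonCMAtTwoOffThetaHabitat :=
  offThetaHabitatAtTwo_r0Partner_of_nonCMAtTwo h

/-- **The off-habitat leaf ⇐ the rung-K4 route items BY NAME** — 19095 `GoodOrdinaryRankZeroAtTwo` ·
19096 `MultiplicativeRankZeroAtTwo` · 19098 `AdditiveRankZeroAtTwo` · 19099 `RankOneAtTwo` (verbatim)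
+ item 19097 `SupersingularRankZeroAtTwo` restricted OFF the habitat
(`offThetaHabitatAtTwo_r0Partner_of_reductionTypesAtTwo_of_ssOffHabitat`). [folklore] -/
theorem wAllNonCMAtTwoOffThetaHabitat_of_reductionTypesAtTwo_of_ssOffHabitat
    (hOrd : ∀ (W : WeierstrassCurve ℚ) [W.IsElliptic] [W.IsGloballyMinimal],
      ¬ W.HasCM → W.analyticRank = 0 → GoodOrd W 2 → BSDp W 2)
    (hMult : ∀ (W : WeierstrassCurve ℚ) [W.IsElliptic] [W.IsGloballyMinimal],
      ¬ W.HasCM → W.analyticRank = 0 → Mult W 2 → BSDp W 2)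
    (hAdd : ∀ (W : WeierstrassCurve ℚ) [W.IsElliptic] [W.IsGloballyMinimal],
      ¬ W.HasCM → W.analyticRank = 0 → Addv W 2 → BSDp W 2)
    (hR1 : ∀ (W : WeierstrassCurve ℚ) [W.IsElliptic] [W.IsGloballyMinimal],
      ¬ W.HasCM → W.analyticRank = 1 → BSDp W 2)
    (hSSoff : ∀ (W : WeierstrassCurve ℚ) [W.IsElliptic] [W.IsGloballyMinimal],
      ¬ W.HasCM → W.analyticRank = 0 → GoodSS W 2 →
      ¬ (W.frobeniusTrace 2 = 0 ∧
          ∃ (A : WeierstrassCurve ℚ) (_ : A.IsElliptic) (_ : A.IsGloballyMinimal),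
            A.HasCM ∧ A.analyticRank = 0 ∧ GoodSS A 2 ∧ A.frobeniusTrace 2 = 0 ∧
              ∃ e : WeierstrassCurve.geomTorsion W (2 : ℤ) ≃+ WeierstrassCurve.geomTorsion A (2 : ℤ),
                ∀ (σ : Field.absoluteGaloisGroup ℚ) (P : WeierstrassCurve.geomTorsion W (2 : ℤ)),
                  e (σ • P) = σ • e P) →
      BSDp W 2) :
    WAllNonCMAtTwoOffThetaHabitat :=
  offThetaHabitatAtTwo_r0Partner_of_reductionTypesAtTwo_of_ssOffHabitat hOrd hMult hAdd hR1 hSSoff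

/-- **Item 19097 `SupersingularRankZeroAtTwo` (K4, verbatim) ⇐ the habitat leaf + the off-habitat
supersingular remainder** (`supersingularRankZeroAtTwo_of_thetaHabitat_r0Partner_of_ssOffHabitat`).
[folklore] -/
theorem supersingularRankZeroAtTwo_of_thetaLeaf_of_ssOffHabitat (hHab : WAllNonCMAtTwoThetaHabitat)
    (hSSoff : ∀ (W : WeierstrassCurve ℚ) [W.IsElliptic] [W.IsGloballyMinimal],
      ¬ W.HasCM → W.analyticRank = 0 → GoodSS W 2 →
      ¬ (W.frobeniusTrace 2 = 0 ∧
          ∃ (A : WeierstrassCurve ℚ) (_ : A.IsElliptic) (_ : A.IsGloballyMinimal),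
            A.HasCM ∧ A.analyticRank = 0 ∧ GoodSS A 2 ∧ A.frobeniusTrace 2 = 0 ∧
              ∃ e : WeierstrassCurve.geomTorsion W (2 : ℤ) ≃+ WeierstrassCurve.geomTorsion A (2 : ℤ),
                ∀ (σ : Field.absoluteGaloisGroup ℚ) (P : WeierstrassCurve.geomTorsion W (2 : ℤ)),
                  e (σ • P) = σ • e P) →
      BSDp W 2) :
    ∀ (W : WeierstrassCurve ℚ) [W.IsElliptic] [W.IsGloballyMinimal],
      ¬ W.HasCM → W.analyticRank = 0 → GoodSS W 2 → BSDp W 2 :=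
  supersingularRankZeroAtTwo_of_thetaHabitat_r0Partner_of_ssOffHabitat hHab hSSoff

/-- **Exactness**: both theta leaves follow from `WAll` (ty-1's `thetaSlices_of_wAll`, recorded here so
the registry below loses and adds nothing). [folklore] -/
theorem thetaLeaves_of_wAll (h : WAll) : WAllNonCMAtTwoThetaHabitat ∧ WAllNonCMAtTwoOffThetaHabitat :=
  thetaSlices_of_wAll h

/-! ## §2 The finest registry with row 1 cut along the theta habitat -/

/-- **THE CLOSED LIST, one hypothesis per registered leaf / live route target / typed residual, row 1
by its two theta leaves** (27 leaf/target hypotheses + `hW` + `hmod` + `hGZK`;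
`wAllExclusions_of_finestLeaves` with `h5 := nonCMAtTwo_of_thetaHabitat_of_offThetaHabitat hHab hOff`).
[folklore] -/
theorem wAllExclusions_of_finestLeaves_theta
    (hHab : WAllNonCMAtTwoThetaHabitat) (hOff : WAllNonCMAtTwoOffThetaHabitat)
    (hM3 : WAllExclAddPotMultAtThree) (hG3 : WAllExclAddPotOrdAtThree)
    (hT3 : WAllExclAddTameSSAtThree) (hW0 : WAllExclAddWildRankZero)
    (hWT : WAllExclAddWildRankOneSurjTwin) (hWO : WAllExclAddWildRankOneOffSurjTwin)
    (h50 : WAllExclAdditiveFiveLeRankZero)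
    (h5S : WAllExclAdditiveFiveLeRankOneSharp) (h5O : WAllExclAdditiveFiveLeRankOneOffSharp)
    (hK2a : X11b.MultiplicativeRankOne) (hK2b : X11b.MultiplicativeRankOneAtThree)
    (hX1B : WAllCornerX1RankZeroBalanced) (hX1U : WAllCornerX1RankZeroUnbalanced)
    (hX1R1 : X1.RankOne.Statement) (hX2 : X2.Target)
    (hK3 : Supersingular.SignedSupersingular)
    (h73 : WAllCornerX7AtThree) (h75 : WAllCornerX7FiveLe)
    (hK6 : BSDpOnClassX9) (hX10b : X10.BSDpOnClassX10b) (hX11a : X11a.Target)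
    (hF3 : WAllCornerFInertBadAtThree) (hF5 : WAllCornerFInertBadFiveLe)
    (hF2 : WAllCornerFTwo) (hFr : WAllCornerFRamified)
    (hW : sha_dvd_analyticSha) (hmod : hasEntireLFunction_rat)
    (hGZK : rank_eq_analyticRank_of_analyticRank_le_one) : WAllExclusions :=
  wAllExclusions_of_finestLeaves
    (Summit.BirchSwinnertonDyer.nonCMAtTwo_of_thetaHabitat_of_offThetaHabitat hHab hOff) hM3 hG3 hT3
    hW0 hWT hWO h50 h5S h5O hK2a hK2b hX1B hX1U hX1R1 hX2 hK3 h73 h75 hK6 hX10b hX11a hF3 hF5 hF2 hFr hW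
    hmod hGZK

/-- **W-ALL from the finest leaves with row 1 cut along the theta habitat, FIFTEEN named facts, the
Gross–Zagier side primary** (`hmod`, `hGZK` derived inside `wAll_of_finestLeaves_primaryGZ`).
[cite: Darmon2004, Thm. 3.22 and §3.9] -/
theorem wAll_of_finestLeaves_theta_primaryGZ
    (hHab : WAllNonCMAtTwoThetaHabitat) (hOff : WAllNonCMAtTwoOffThetaHabitat)
    (hM3 : WAllExclAddPotMultAtThree) (hG3 : WAllExclAddPotOrdAtThree)
    (hT3 : WAllExclAddTameSSAtThree) (hW0 : WAllExclAddWildRankZero)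
    (hWT : WAllExclAddWildRankOneSurjTwin) (hWO : WAllExclAddWildRankOneOffSurjTwin)
    (h50 : WAllExclAdditiveFiveLeRankZero)
    (h5S : WAllExclAdditiveFiveLeRankOneSharp) (h5O : WAllExclAdditiveFiveLeRankOneOffSharp)
    (hK2a : X11b.MultiplicativeRankOne) (hK2b : X11b.MultiplicativeRankOneAtThree)
    (hX1B : WAllCornerX1RankZeroBalanced) (hX1U : WAllCornerX1RankZeroUnbalanced)
    (hX1R1 : X1.RankOne.Statement) (hX2 : X2.Target)
    (hK3 : Supersingular.SignedSupersingular)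
    (h73 : WAllCornerX7AtThree) (h75 : WAllCornerX7FiveLe)
    (hK6 : BSDpOnClassX9) (hX10b : X10.BSDpOnClassX10b) (hX11a : X11a.Target)
    (hF3 : WAllCornerFInertBadAtThree) (hF5 : WAllCornerFInertBadFiveLe)
    (hF2 : WAllCornerFTwo) (hFr : WAllCornerFRamified)
    (hW : sha_dvd_analyticSha)
    (hSk : Skinner2016.thmC_padicValRat_bsd_rank_zero)
    (hBCS : BurungaleCastellaSkinner2025.cor131_padicValRat_bsd_rank_le_one)
    (hJSW : JetchevSkinnerWan2017.thm121_padicValRat_bsd_rank_one)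
    (hCGS : CastellaGrossiSkinner2025.thmD_padicValRat_bsd_rank_le_one)
    (hGV : GreenbergVatsal2000.thm13_charIdeal_eq_of_gvPar) (hGr : greenberg_charValue_rankZero)
    (hmodP : nonempty_modularParametrizationData)
    (hWa : waldspurger_exists_heegnerField_twist_ne_zero)
    (hMM : murtyMurty_exists_heegnerField_twist_simpleZero)
    (hGZ : ∀ (N : ℕ) [NeZero N] (W : WeierstrassCurve ℚ) (K : Type) [Field K] [NumberField K],
      gross_zagier N W K)
    (hKo : ∀ (N : ℕ) [NeZero N] (W : WeierstrassCurve ℚ) (K : Type) [Field K] [NumberField K],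
      kolyvagin N W K)
    (hCM : bsdTriple_of_hasCM_of_L_one_ne_zero) (hKob : Kobayashi2013.cor14_bsdp_of_cm_rank_one)
    (hYZ : YanZhu2026.thm415_padicValRat_bsd_rank_le_one)
    (hLLT : LiLiuTian2024.thm11_bsdp_of_cm_rank_one) : WAll :=
  wAll_of_finestLeaves_primaryGZ
    (Summit.BirchSwinnertonDyer.nonCMAtTwo_of_thetaHabitat_of_offThetaHabitat hHab hOff) hM3 hG3 hT3
    hW0 hWT hWO h50 h5S h5O hK2a hK2b hX1B hX1U hX1R1 hX2 hK3 h73 h75 hK6 hX10b hX11a hF3 hF5 hF2 hFr hW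
    hSk hBCS hJSW hCGS hGV hGr hmodP hWa hMM hGZ hKo hCM hKob hYZ hLLT

/-- **THE FULL BSD FORMULA FOR EVERY `E/ℚ` OF ANALYTIC RANK `≤ 1`** from the finest leaves with row
1 cut along the theta habitat: FIFTEEN named facts and ONE sign binder `hL0`.
[cite: GrossZagier1986, Thm. V.(2.1) (p. 311) and V.§2 (pp. 312–313)]
[cite: Darmon2004, Thm. 3.22 and §3.9] -/
theorem wAllFormula_of_finestLeaves_theta_primaryGZ
    (hHab : WAllNonCMAtTwoThetaHabitat) (hOff : WAllNonCMAtTwoOffThetaHabitat)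
    (hM3 : WAllExclAddPotMultAtThree) (hG3 : WAllExclAddPotOrdAtThree)
    (hT3 : WAllExclAddTameSSAtThree) (hW0 : WAllExclAddWildRankZero)
    (hWT : WAllExclAddWildRankOneSurjTwin) (hWO : WAllExclAddWildRankOneOffSurjTwin)
    (h50 : WAllExclAdditiveFiveLeRankZero)
    (h5S : WAllExclAdditiveFiveLeRankOneSharp) (h5O : WAllExclAdditiveFiveLeRankOneOffSharp)
    (hK2a : X11b.MultiplicativeRankOne) (hK2b : X11b.MultiplicativeRankOneAtThree)
    (hX1B : WAllCornerX1RankZeroBalanced) (hX1U : WAllCornerX1RankZeroUnbalanced)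
    (hX1R1 : X1.RankOne.Statement) (hX2 : X2.Target)
    (hK3 : Supersingular.SignedSupersingular)
    (h73 : WAllCornerX7AtThree) (h75 : WAllCornerX7FiveLe)
    (hK6 : BSDpOnClassX9) (hX10b : X10.BSDpOnClassX10b) (hX11a : X11a.Target)
    (hF3 : WAllCornerFInertBadAtThree) (hF5 : WAllCornerFInertBadFiveLe)
    (hF2 : WAllCornerFTwo) (hFr : WAllCornerFRamified)
    (hW : sha_dvd_analyticSha)
    (hSk : Skinner2016.thmC_padicValRat_bsd_rank_zero)
    (hBCS : BurungaleCastellaSkinner2025.cor131_padicValRat_bsd_rank_le_one)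
    (hJSW : JetchevSkinnerWan2017.thm121_padicValRat_bsd_rank_one)
    (hCGS : CastellaGrossiSkinner2025.thmD_padicValRat_bsd_rank_le_one)
    (hGV : GreenbergVatsal2000.thm13_charIdeal_eq_of_gvPar) (hGr : greenberg_charValue_rankZero)
    (hmodP : nonempty_modularParametrizationData)
    (hWa : waldspurger_exists_heegnerField_twist_ne_zero)
    (hMM : murtyMurty_exists_heegnerField_twist_simpleZero)
    (hGZ : ∀ (N : ℕ) [NeZero N] (W : WeierstrassCurve ℚ) (K : Type) [Field K] [NumberField K],
      gross_zagier N W K)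
    (hKo : ∀ (N : ℕ) [NeZero N] (W : WeierstrassCurve ℚ) (K : Type) [Field K] [NumberField K],
      kolyvagin N W K)
    (hCM : bsdTriple_of_hasCM_of_L_one_ne_zero) (hKob : Kobayashi2013.cor14_bsdp_of_cm_rank_one)
    (hYZ : YanZhu2026.thm415_padicValRat_bsd_rank_le_one)
    (hLLT : LiLiuTian2024.thm11_bsdp_of_cm_rank_one)
    (hL0 : re_entireLFunction_one_nonneg) : WAllFormula :=
  wAllFormula_of_wAll_oneSign hmodP hL0 hWa hGZ
    (wAll_of_finestLeaves_theta_primaryGZ hHab hOff hM3 hG3 hT3 hW0 hWT hWO h50 h5S h5O hK2a hK2b hX1B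
      hX1U hX1R1 hX2 hK3 h73 h75 hK6 hX10b hX11a hF3 hF5 hF2 hFr hW hSk hBCS hJSW hCGS hGV hGr hmodP hWa
      hMM hGZ hKo hCM hKob hYZ hLLT)

end Summit.BirchSwinnertonDyer.Rank1Residual.WAll

end
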